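/-
Copyright (c) 2026 the pub-hodgecm-mathlib formalisation cell (harness21).  Prover seat hodgecm-mathlib-LH4-p08 (g5), Track A «(D-RAM) FOUR-FRAME», unit U2H, the census leaf
(ρ2b′-X) `stub_U2H_fixedPointCensus_typeTwo_unit0` — the RE-INDEXING between the order-count socket (hOC) and the T5s weld, type U.  2026-09-04.
-/
import Summits.HodgeConjecture.HodgeConjecture.Theorems.F0P3cDyRamToricLevelCensusUnr          -- ★ p857436 (this lineage): `levelSet_eq_setOf`
import Summits.HodgeConjecture.HodgeConjecture.Theorems.F0P3cDyRamToricLevelCensusUnrDep       -- ★ p857473 (this lineage): (R1-A0) `ncard_levelSetDep_zero`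
import Summits.HodgeConjecture.HodgeConjecture.Theorems.F0P3cDyRamOrderFiltrationRange        -- ★ (LH4-p12 (g4)) (α): `sum_range_ite_isOrd_eq_sum_range` (indicator → range)
import HarnessLib

/-!
# T5a, type U: re-indexing the order-count socket into the T5s weld's double sum

The census's order-count socket (hOC, payer LH4-p14 ∕ LH4-p11 (C0b-2)) presents each side as
`Σ_{j < J+1} [λ ∈ 𝒪_j]·#levelSet(j,0) + Σ_{b ∈ Icc 1 R} Σ_{j < J+1} [λ ∈ 𝒪_j]·q^b·#levelSetDep(j,b;μ)` (cut-offs `J`, `R`), while the ★ T5s weld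
(`toricCensusSum_unr_weld`) consumes `Σ_{j < jλ+1} Σ_{a < jλ+2} q^a·#levelSetDep(j,a;μ)`.  On type U these agree as soon as `jλ ≤ J` and `jλ + 1 ≤ R`: the indicator is
`[j ≤ jλ]` (★ (α)), the `a = 0` column passes the depth test for `j ≤ jλ` (★ (R1-A0)), and EVERY cell with `a ≥ j + 1` is EMPTY (`y∕ϖE` would still lie in `𝒪_j`, so the
dual generator is not Gram-primitive) — proved here for any scalar `h` (no hyperbolic ∕ anisotropic split, no third-field package).
HONEST LABEL: HC_CM is proved only modulo the 7 printed citations (2 remaining named inputs: hLiu418 = stmt-HodgeConjecture-24832,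
h413 = stmt-HodgeConjecture-24833) until rung 0 closes; (ρ2b′-X) :418 is an OPEN prover target — this file is a helper (`--supports`), proofs only.
-/

set_option autoImplicit false

open WithZero IsLocalRing Finset
open scoped Valued Classical

namespace Summit.HodgeConjecture.HodgeConjecture.Cruxes.H413.F0P3cDyRamToricLevelCensusUnr

open Summit.HodgeConjecture.HodgeConjecture.Cruxes.H413.F0P3cDyRamToricCensusDefs
open Summit.HodgeConjecture.HodgeConjecture.Cruxes.H413.F0P3cDyRamOrderFiltrationRange (sum_range_ite_isOrd_eq_sum_range)

variable {K : Type*} [Field K] [Valued K ℤᵐ⁰] {ρ Θ : K →+* K} {α ϖE h : K}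

/-! ## §1 Cells above the diagonal `a = j` are empty -/

/-- **NO LEVEL BEYOND THE CONDUCTOR**: on type U (`|α − ρα| = 1`, `|ϖE| = exp(−1)`), `levelSet(j,a) = ∅` whenever `j + 1 ≤ a` — a dual generator `y` of level
`|ϖE|^a`, `a ≥ j + 1`, has `y∕ϖE ∈ 𝒪_j` (`|y∕ϖE| = exp(−(a−1)) ≤ exp(−j) = |ϖE^j(α − ρα)|`), contradicting Gram-primitivity.  Any scalar `h`.
[cite: Jacobowitz1962, §4] [cite: Flicker1998UnitaryFL, p. 84] -/
theorem levelSet_eq_empty_of_succ_le (hvρ : ∀ x, Valued.v (ρ x) = Valued.v x) (hα : Valued.v (α - ρ α) = 1) (hϖE : Valued.v ϖE = exp (-1 : ℤ))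
    (h : K) {j a : ℕ} (hja : j + 1 ≤ a) : levelSet ρ Θ α ϖE h j a = ∅ := by
  have hϖ0 : ϖE ≠ 0 := fun h0 => by rw [h0, map_zero] at hϖE; exact (exp_ne_zero hϖE.symm).elim
  have hvc : Valued.v (ϖE ^ j * (α - ρ α)) = exp (-(j : ℤ)) := by
    rw [map_mul, hα, mul_one, map_pow, hϖE, ← exp_nsmul, nsmul_eq_mul, mul_neg, mul_one]
  rw [levelSet_eq_setOf hϖE]
  ext Λ
  simp only [Set.mem_setOf_eq, Set.mem_empty_iff_false, iff_false]
  rintro ⟨x₀, -, -, hPQ, hE⟩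
  refine hPQ.2 ⟨?_, ?_⟩
  · rw [map_div₀, hE, hϖE, ← exp_sub, ← exp_zero, exp_le_exp]; omega
  · have hq : Valued.v (h * (x₀ * Θ x₀) * (ϖE ^ j * (α - ρ α)) / ϖE) = exp (-((a : ℤ) - 1)) := by
      rw [map_div₀, hE, hϖE, ← exp_sub]; congr 1; ring
    refine (Valuation.map_sub _ _ _).trans ?_
    rw [hvρ, max_self, hq, hvc, exp_le_exp]; omega

/-- Hence `#levelSetDep(j,a;μ) = 0` for `j + 1 ≤ a` (type U, any `h`, any `μ`). [cite: Jacobowitz1962, §4] -/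
theorem ncard_levelSetDep_eq_zero_of_succ_le (hvρ : ∀ x, Valued.v (ρ x) = Valued.v x) (hα : Valued.v (α - ρ α) = 1)
    (hϖE : Valued.v ϖE = exp (-1 : ℤ)) (h μ : K) {j a : ℕ} (hja : j + 1 ≤ a) : (levelSetDep ρ Θ α ϖE h j a μ).ncard = 0 := by
  have hsub : levelSetDep ρ Θ α ϖE h j a μ = ∅ :=
    Set.eq_empty_of_subset_empty fun Λ hΛ => (levelSet_eq_empty_of_succ_le (Θ := Θ) hvρ hα hϖE h hja) ▸ hΛ.1
  rw [hsub, Set.ncard_empty]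

/-! ## §2 One row: the socket's `#levelSet(j,0) + Σ_{b ∈ Icc 1 R} q^b·#levelSetDep(j,b;μ)` is the weld's `Σ_{a < jλ+2} q^a·#levelSetDep(j,a;μ)` -/

/-- **ONE ROW.**  For `j ≤ jλ` and a cut-off `R ≥ jλ + 1`:
`#levelSet(j,0) + Σ_{b ∈ Icc 1 R} q^b·#levelSetDep(j,b;μ) = Σ_{a ∈ range (jλ+2)} q^a·#levelSetDep(j,a;μ)` — the `a = 0` column passes the depth test (★ (R1-A0)) and the cells
`a ≥ j + 1` are empty on both sides. [cite: Kottwitz1986BaseChangeUnits, §1 pp. 240–241] [cite: Jacobowitz1962, §4] -/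
theorem ncard_levelSet_zero_add_sum_Icc_eq_sum_range (hρρ : ∀ x, ρ (ρ x) = x) (hvρ : ∀ x, Valued.v (ρ x) = Valued.v x) (hΘΘ : ∀ x, Θ (Θ x) = x)
    (hΘρ : ∀ x, Θ (ρ x) = ρ (Θ x)) (hvΘ : ∀ x, Valued.v (Θ x) = Valued.v x) (hα1 : Valued.v α ≤ 1) (hα : Valued.v (α - ρ α) = 1)
    (hρϖE : ρ ϖE = ϖE) (hϖE : Valued.v ϖE = exp (-1 : ℤ)) (hh : h ≠ 0)
    {μ : K} {m jl : ℕ} (hm : Valued.v μ = exp (-(m : ℤ))) (hjl : Valued.v (μ - ρ μ) = exp (-(jl : ℤ))) (q : ℕ)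
    {j : ℕ} (hj : j ≤ jl) {R : ℕ} (hR : jl + 1 ≤ R) :
    (levelSet ρ Θ α ϖE h j 0).ncard + ∑ b ∈ Icc 1 R, q ^ b * (levelSetDep ρ Θ α ϖE h j b μ).ncard =
      ∑ a ∈ range (jl + 2), q ^ a * (levelSetDep ρ Θ α ϖE h j a μ).ncard := by
  set f : ℕ → ℕ := fun a => q ^ a * (levelSetDep ρ Θ α ϖE h j a μ).ncard with hf
  have hf0 : ∀ a, jl + 2 ≤ a → f a = 0 := fun a ha => by
    rw [hf]; dsimp only
    rw [ncard_levelSetDep_eq_zero_of_succ_le (Θ := Θ) hvρ hα hϖE h μ (by omega : j + 1 ≤ a), mul_zero]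
  -- both sides equal `Σ_{a < R+1} f a`
  have hL : (levelSet ρ Θ α ϖE h j 0).ncard + ∑ b ∈ Icc 1 R, f b = ∑ a ∈ range (R + 1), f a := by
    rw [sum_range_succ', ← Finset.Ico_add_one_right_eq_Icc, sum_Ico_eq_sum_range, add_comm]
    congr 1
    · refine sum_congr (by rw [Nat.add_sub_cancel]) fun k _ => by rw [add_comm]
    · rw [hf]; dsimp only
      rw [pow_zero, one_mul, ncard_levelSetDep_zero hρρ hvρ hΘΘ hΘρ hvΘ hα1 hα hρϖE hϖE hh hm hjl hj]
  have hRHS : ∑ a ∈ range (jl + 2), f a = ∑ a ∈ range (R + 1), f a :=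
    sum_subset (range_subset_range.2 (by omega)) fun a _ hna => hf0 a (by rw [mem_range, not_lt] at hna; omega)
  rw [hL, hRHS]

/-! ## §3 The whole socket side -/

/-- **THE ORDER-COUNT SOCKET RE-INDEXED (type U, one scalar).**  With the indicator law `λ ∈ 𝒪_j ⟺ j ≤ jλ` (★ (α) `isOrd_pow_iff_le`), a cut-off `J ≥ jλ` and a
tube bound `R ≥ jλ + 1`:
`Σ_{j < J+1} [λ ∈ 𝒪_j]·#levelSet(j,0) + Σ_{b ∈ Icc 1 R} Σ_{j < J+1} [λ ∈ 𝒪_j]·q^b·#levelSetDep(j,b;μ) = Σ_{j < jλ+1} Σ_{a < jλ+2} q^a·#levelSetDep(j,a;μ)` —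
the left side is the (hOC) socket's shape, the right side the T5s weld's (`toricCensusSum_unr_weld`). [cite: Kottwitz1986BaseChangeUnits, §1 pp. 240–241]
[cite: Rogawski1990, §4.9 Prop. 4.9.1 (b) p. 55, Lemma 4.9.3 p. 56] -/
theorem orderCounts_eq_censusSum_unr (hρρ : ∀ x, ρ (ρ x) = x) (hvρ : ∀ x, Valued.v (ρ x) = Valued.v x) (hΘΘ : ∀ x, Θ (Θ x) = x)
    (hΘρ : ∀ x, Θ (ρ x) = ρ (Θ x)) (hvΘ : ∀ x, Valued.v (Θ x) = Valued.v x) (hα1 : Valued.v α ≤ 1) (hα : Valued.v (α - ρ α) = 1)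
    (hρϖE : ρ ϖE = ϖE) (hϖE : Valued.v ϖE = exp (-1 : ℤ)) (hh : h ≠ 0)
    {μ : K} {m jl : ℕ} (hm : Valued.v μ = exp (-(m : ℤ))) (hjl : Valued.v (μ - ρ μ) = exp (-(jl : ℤ))) (q : ℕ)
    {lam : K} (hiff : ∀ j, IsOrd ρ α (ϖE ^ j) lam ↔ j ≤ jl) {J : ℕ} (hJ : jl ≤ J) {R : ℕ} (hR : jl + 1 ≤ R) :
    (∑ j ∈ range (J + 1), (if IsOrd ρ α (ϖE ^ j) lam then (levelSet ρ Θ α ϖE h j 0).ncard else 0)) +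
        ∑ b ∈ Icc 1 R, ∑ j ∈ range (J + 1), (if IsOrd ρ α (ϖE ^ j) lam then q ^ b * (levelSetDep ρ Θ α ϖE h j b μ).ncard else 0) =
      ∑ j ∈ range (jl + 1), ∑ a ∈ range (jl + 2), q ^ a * (levelSetDep ρ Θ α ϖE h j a μ).ncard := by
  rw [sum_range_ite_isOrd_eq_sum_range hiff hJ]
  have hinner : ∀ b, ∑ j ∈ range (J + 1), (if IsOrd ρ α (ϖE ^ j) lam then q ^ b * (levelSetDep ρ Θ α ϖE h j b μ).ncard else 0) =
      ∑ j ∈ range (jl + 1), q ^ b * (levelSetDep ρ Θ α ϖE h j b μ).ncard := fun b =>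
    sum_range_ite_isOrd_eq_sum_range hiff hJ _
  simp_rw [hinner]
  rw [sum_comm, ← sum_add_distrib]
  refine sum_congr rfl fun j hj' => ?_
  exact ncard_levelSet_zero_add_sum_Icc_eq_sum_range hρρ hvρ hΘΘ hΘρ hvΘ hα1 hα hρϖE hϖE hh hm hjl q (by rw [mem_range] at hj'; omega) hR

/-! ## §4 (ED. 2, append-only) The depth rule `a ≤ m`, and the re-index with the weaker cut-off `min m jλ ≤ R` -/

/-- **THE T5a DEPTH RULE**: a member of `levelSetDep(j,a;μ)` has `a ≤ m` (`|μ| = exp(−m)`): the depth condition `μΛ^# ⊆ Λ` forces `μ∕y ∈ 𝒪_j`, i.e. `|μ| ≤ |y|`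
(★ `dep_iff_of_witness`, first conjunct).  Hence `levelSetDep(j,a;μ) = ∅` for `m < a` — type U, any `h ≠ 0`. [cite: Kottwitz1986BaseChangeUnits, §1 pp. 240–241] [cite: Jacobowitz1962, §4] -/
theorem levelSetDep_eq_empty_of_lt (hρρ : ∀ x, ρ (ρ x) = x) (hvρ : ∀ x, Valued.v (ρ x) = Valued.v x) (hΘΘ : ∀ x, Θ (Θ x) = x)
    (hΘρ : ∀ x, Θ (ρ x) = ρ (Θ x)) (hvΘ : ∀ x, Valued.v (Θ x) = Valued.v x) (hα1 : Valued.v α ≤ 1) (hα : Valued.v (α - ρ α) = 1)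
    (hρϖE : ρ ϖE = ϖE) (hϖE : Valued.v ϖE = exp (-1 : ℤ)) (hh : h ≠ 0)
    {μ : K} {m : ℕ} (hm : Valued.v μ = exp (-(m : ℤ))) {j a : ℕ} (hma : m < a) : levelSetDep ρ Θ α ϖE h j a μ = ∅ := by
  ext Λ
  simp only [Set.mem_empty_iff_false, iff_false]
  rintro ⟨⟨x₀, hx₀, hΛx, -, -, hya⟩, hdep⟩
  have ham := ((dep_iff_of_witness hρρ hvρ hΘΘ hΘρ hvΘ hα1 hα hρϖE hϖE hh hm hx₀ hΛx hya).1 hdep).1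
  omega

/-- `#levelSetDep(j,a;μ) = 0` for `m < a`. [cite: Jacobowitz1962, §4] -/
theorem ncard_levelSetDep_eq_zero_of_lt (hρρ : ∀ x, ρ (ρ x) = x) (hvρ : ∀ x, Valued.v (ρ x) = Valued.v x) (hΘΘ : ∀ x, Θ (Θ x) = x)
    (hΘρ : ∀ x, Θ (ρ x) = ρ (Θ x)) (hvΘ : ∀ x, Valued.v (Θ x) = Valued.v x) (hα1 : Valued.v α ≤ 1) (hα : Valued.v (α - ρ α) = 1)
    (hρϖE : ρ ϖE = ϖE) (hϖE : Valued.v ϖE = exp (-1 : ℤ)) (hh : h ≠ 0)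
    {μ : K} {m : ℕ} (hm : Valued.v μ = exp (-(m : ℤ))) {j a : ℕ} (hma : m < a) : (levelSetDep ρ Θ α ϖE h j a μ).ncard = 0 := by
  rw [levelSetDep_eq_empty_of_lt hρρ hvρ hΘΘ hΘρ hvΘ hα1 hα hρϖE hϖE hh hm hma, Set.ncard_empty]

/-- **ONE ROW, weaker cut-off**: for `j ≤ jλ` and `R ≥ min m jλ`,
`#levelSet(j,0) + Σ_{b ∈ Icc 1 R} q^b·#levelSetDep(j,b;μ) = Σ_{a ∈ range (jλ+2)} q^a·#levelSetDep(j,a;μ)` — a non-empty cell has `a ≤ j ≤ jλ` (§1) and `a ≤ m` (§4).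
[cite: Kottwitz1986BaseChangeUnits, §1 pp. 240–241] [cite: Jacobowitz1962, §4] -/
theorem ncard_levelSet_zero_add_sum_Icc_eq_sum_range_of_min_le (hρρ : ∀ x, ρ (ρ x) = x) (hvρ : ∀ x, Valued.v (ρ x) = Valued.v x)
    (hΘΘ : ∀ x, Θ (Θ x) = x) (hΘρ : ∀ x, Θ (ρ x) = ρ (Θ x)) (hvΘ : ∀ x, Valued.v (Θ x) = Valued.v x) (hα1 : Valued.v α ≤ 1)
    (hα : Valued.v (α - ρ α) = 1) (hρϖE : ρ ϖE = ϖE) (hϖE : Valued.v ϖE = exp (-1 : ℤ)) (hh : h ≠ 0)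
    {μ : K} {m jl : ℕ} (hm : Valued.v μ = exp (-(m : ℤ))) (hjl : Valued.v (μ - ρ μ) = exp (-(jl : ℤ))) (q : ℕ)
    {j : ℕ} (hj : j ≤ jl) {R : ℕ} (hR : min m jl ≤ R) :
    (levelSet ρ Θ α ϖE h j 0).ncard + ∑ b ∈ Icc 1 R, q ^ b * (levelSetDep ρ Θ α ϖE h j b μ).ncard =
      ∑ a ∈ range (jl + 2), q ^ a * (levelSetDep ρ Θ α ϖE h j a μ).ncard := by
  set f : ℕ → ℕ := fun a => q ^ a * (levelSetDep ρ Θ α ϖE h j a μ).ncard with hf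
  -- every cell beyond `min m j` vanishes
  have hf0 : ∀ a, min m j < a → f a = 0 := fun a ha => by
    rw [hf]; dsimp only
    rcases lt_or_ge m a with hma | hma
    · rw [ncard_levelSetDep_eq_zero_of_lt hρρ hvρ hΘΘ hΘρ hvΘ hα1 hα hρϖE hϖE hh hm hma, mul_zero]
    · rw [ncard_levelSetDep_eq_zero_of_succ_le (Θ := Θ) hvρ hα hϖE h μ (by omega : j + 1 ≤ a), mul_zero]
  -- both sides equal `Σ_{a < N+1} f a` for `N := max R (jl + 1)`
  have hL : (levelSet ρ Θ α ϖE h j 0).ncard + ∑ b ∈ Icc 1 R, f b = ∑ a ∈ range (R + 1), f a := by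
    rw [sum_range_succ', ← Finset.Ico_add_one_right_eq_Icc, sum_Ico_eq_sum_range, add_comm]
    congr 1
    · refine sum_congr (by rw [Nat.add_sub_cancel]) fun k _ => by rw [add_comm]
    · rw [hf]; dsimp only
      rw [pow_zero, one_mul, ncard_levelSetDep_zero hρρ hvρ hΘΘ hΘρ hvΘ hα1 hα hρϖE hϖE hh hm hjl hj]
  have hL' : ∑ a ∈ range (R + 1), f a = ∑ a ∈ range (max R (jl + 1) + 1), f a :=
    sum_subset (range_subset_range.2 (by omega)) fun a _ hna => hf0 a (by rw [mem_range, not_lt] at hna; omega)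
  have hR' : ∑ a ∈ range (jl + 2), f a = ∑ a ∈ range (max R (jl + 1) + 1), f a :=
    sum_subset (range_subset_range.2 (by omega)) fun a _ hna => hf0 a (by rw [mem_range, not_lt] at hna; omega)
  rw [hL, hL', hR']

/-- **THE ORDER-COUNT SOCKET RE-INDEXED, weaker cut-off** (`R ≥ min m jλ` instead of `R ≥ jλ + 1`): same two sides as `orderCounts_eq_censusSum_unr`.
[cite: Kottwitz1986BaseChangeUnits, §1 pp. 240–241] [cite: Rogawski1990, §4.9 Prop. 4.9.1 (b) p. 55, Lemma 4.9.3 p. 56] -/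
theorem orderCounts_eq_censusSum_unr_of_min_le (hρρ : ∀ x, ρ (ρ x) = x) (hvρ : ∀ x, Valued.v (ρ x) = Valued.v x) (hΘΘ : ∀ x, Θ (Θ x) = x)
    (hΘρ : ∀ x, Θ (ρ x) = ρ (Θ x)) (hvΘ : ∀ x, Valued.v (Θ x) = Valued.v x) (hα1 : Valued.v α ≤ 1) (hα : Valued.v (α - ρ α) = 1)
    (hρϖE : ρ ϖE = ϖE) (hϖE : Valued.v ϖE = exp (-1 : ℤ)) (hh : h ≠ 0)
    {μ : K} {m jl : ℕ} (hm : Valued.v μ = exp (-(m : ℤ))) (hjl : Valued.v (μ - ρ μ) = exp (-(jl : ℤ))) (q : ℕ)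
    {lam : K} (hiff : ∀ j, IsOrd ρ α (ϖE ^ j) lam ↔ j ≤ jl) {J : ℕ} (hJ : jl ≤ J) {R : ℕ} (hR : min m jl ≤ R) :
    (∑ j ∈ range (J + 1), (if IsOrd ρ α (ϖE ^ j) lam then (levelSet ρ Θ α ϖE h j 0).ncard else 0)) +
        ∑ b ∈ Icc 1 R, ∑ j ∈ range (J + 1), (if IsOrd ρ α (ϖE ^ j) lam then q ^ b * (levelSetDep ρ Θ α ϖE h j b μ).ncard else 0) =
      ∑ j ∈ range (jl + 1), ∑ a ∈ range (jl + 2), q ^ a * (levelSetDep ρ Θ α ϖE h j a μ).ncard := by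
  rw [sum_range_ite_isOrd_eq_sum_range hiff hJ]
  have hinner : ∀ b, ∑ j ∈ range (J + 1), (if IsOrd ρ α (ϖE ^ j) lam then q ^ b * (levelSetDep ρ Θ α ϖE h j b μ).ncard else 0) =
      ∑ j ∈ range (jl + 1), q ^ b * (levelSetDep ρ Θ α ϖE h j b μ).ncard := fun b =>
    sum_range_ite_isOrd_eq_sum_range hiff hJ _
  simp_rw [hinner]
  rw [sum_comm, ← sum_add_distrib]
  refine sum_congr rfl fun j hj' => ?_
  exact ncard_levelSet_zero_add_sum_Icc_eq_sum_range_of_min_le hρρ hvρ hΘΘ hΘρ hvΘ hα1 hα hρϖE hϖE hh hm hjl q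
    (by rw [mem_range] at hj'; omega) hR

/-- **THE ORDER-COUNT SOCKET RE-INDEXED, CELL-BOUND FORM** (bottom (A), LH4-p11 (g5)): instead of a numeric cut-off, the socket's tube bound read on CELLS —
`hRcells : ∀ j b, 1 ≤ b → λ ∈ 𝒪_j → levelSetDep(j,b;μ) ≠ ∅ → b ≤ R` (LH4-p05 (g4) `le_of_levelSetDep_nonempty`, from `hR` via ★ (β)); then the cells `b > R` of the rows
`j ≤ jλ` are empty, the sum over `Icc 1 R` extends to `Icc 1 (max R (jλ+1))`, and `orderCounts_eq_censusSum_unr`'s row identity applies.  Same two sides.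
[cite: Kottwitz1986BaseChangeUnits, §1 pp. 240–241] [cite: Rogawski1990, §4.9 Prop. 4.9.1 (b) p. 55, Lemma 4.9.3 p. 56] -/
theorem orderCounts_eq_censusSum_unr_of_cells (hρρ : ∀ x, ρ (ρ x) = x) (hvρ : ∀ x, Valued.v (ρ x) = Valued.v x) (hΘΘ : ∀ x, Θ (Θ x) = x)
    (hΘρ : ∀ x, Θ (ρ x) = ρ (Θ x)) (hvΘ : ∀ x, Valued.v (Θ x) = Valued.v x) (hα1 : Valued.v α ≤ 1) (hα : Valued.v (α - ρ α) = 1)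
    (hρϖE : ρ ϖE = ϖE) (hϖE : Valued.v ϖE = exp (-1 : ℤ)) (hh : h ≠ 0)
    {μ : K} {m jl : ℕ} (hm : Valued.v μ = exp (-(m : ℤ))) (hjl : Valued.v (μ - ρ μ) = exp (-(jl : ℤ))) (q : ℕ)
    {lam : K} (hiff : ∀ j, IsOrd ρ α (ϖE ^ j) lam ↔ j ≤ jl) {J : ℕ} (hJ : jl ≤ J) {R : ℕ}
    (hRcells : ∀ j b, 1 ≤ b → IsOrd ρ α (ϖE ^ j) lam → (levelSetDep ρ Θ α ϖE h j b μ).Nonempty → b ≤ R) :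
    (∑ j ∈ range (J + 1), (if IsOrd ρ α (ϖE ^ j) lam then (levelSet ρ Θ α ϖE h j 0).ncard else 0)) +
        ∑ b ∈ Icc 1 R, ∑ j ∈ range (J + 1), (if IsOrd ρ α (ϖE ^ j) lam then q ^ b * (levelSetDep ρ Θ α ϖE h j b μ).ncard else 0) =
      ∑ j ∈ range (jl + 1), ∑ a ∈ range (jl + 2), q ^ a * (levelSetDep ρ Θ α ϖE h j a μ).ncard := by
  rw [sum_range_ite_isOrd_eq_sum_range hiff hJ]
  have hinner : ∀ b, ∑ j ∈ range (J + 1), (if IsOrd ρ α (ϖE ^ j) lam then q ^ b * (levelSetDep ρ Θ α ϖE h j b μ).ncard else 0) =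
      ∑ j ∈ range (jl + 1), q ^ b * (levelSetDep ρ Θ α ϖE h j b μ).ncard := fun b =>
    sum_range_ite_isOrd_eq_sum_range hiff hJ _
  simp_rw [hinner]
  rw [sum_comm, ← sum_add_distrib]
  refine sum_congr rfl fun j hj' => ?_
  have hj : j ≤ jl := by rw [mem_range] at hj'; omega
  -- the cells `b > R` of this row are empty: extend the sum to `Icc 1 (max R (jl + 1))`
  have hext : ∑ b ∈ Icc 1 R, q ^ b * (levelSetDep ρ Θ α ϖE h j b μ).ncard =
      ∑ b ∈ Icc 1 (max R (jl + 1)), q ^ b * (levelSetDep ρ Θ α ϖE h j b μ).ncard := by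
    refine sum_subset (Icc_subset_Icc_right (le_max_left _ _)) fun b hb hnb => ?_
    rw [mem_Icc] at hb hnb
    have hempty : levelSetDep ρ Θ α ϖE h j b μ = ∅ :=
      Set.not_nonempty_iff_eq_empty.1 fun hne => hnb ⟨hb.1, hRcells j b hb.1 ((hiff j).2 hj) hne⟩
    rw [hempty, Set.ncard_empty, mul_zero]
  rw [hext]
  exact ncard_levelSet_zero_add_sum_Icc_eq_sum_range hρρ hvρ hΘΘ hΘρ hvΘ hα1 hα hρϖE hϖE hh hm hjl q hj (le_max_right _ _)

end Summit.HodgeConjecture.HodgeConjecture.Cruxes.H413.F0P3cDyRamToricLevelCensusUnr
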